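import Literature.Probability.RandomPlanarGeometry.ChordalBoundary
import Literature.Probability.RandomPlanarGeometry.MarkedDomainCorners
import Literature.Probability.RandomPlanarGeometry.ConformalRectangle
import Literature.Probability.RandomPlanarGeometry.ConformalMapCaratheodoryProofs
import Mathlib.Analysis.SpecialFunctions.Complex.LogDeriv
import HarnessLib

/-!
# Dobrushin domains in the disc picture: where the two boundary arcs go, and the comparison harmonic function

Topic `Literature/Probability/LatticeModels` (conformal-geometry glue for lattice scaling
limits); an instalment (item B4 of the road recorded in `Sweep1Proofs.lean`, module docstring
§2b) of the discharge programme for crit-ising.S18 / Smirnov's Theorem 2.2. The uniqueness step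
at the end of §5 of Smirnov 2010 identifies the limit of the FK primitives with the harmonic
measure `Im Φ` through its boundary values `0` on `(ab)` and `1` on `(ba)`; in the tree the
conformal map enters as a chordal uniformizing map `φ : ℍ → D` (`IsChordalUniformizing`), and the
boundary correspondence is Carathéodory's theorem in disc form (proved in the tree:
`JordanDomain.exists_continuousOn_extension_holds`, packaged as `JordanDomain.IsDiscExtension`
in `ChordalBoundary.lean`). This file supplies what the disc picture needs: the disc extension
`Φ` maps `1 ↦ b`, `-1 ↦ a` and one open semicircle into each open boundary arc
(`exists_semicircle_arcs`); the comparison function `ϖ = arg(cayley⁻¹ ·)/π` is the imaginary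
part of a holomorphic function on the disc, takes values in `[0,1]` there, and tends to `0` on
the lower and to `1` on the upper open semicircle; and boundary estimates for a function on `D`
transfer to `hD ∘ Φ` on the disc (`discExt_transfer`). Everything is proved.

* `DobrushinArcs.arc_union`, `mem_arc_inter`, `exists_mem_arc_not_mem`; `discExt_apply_one`,
  `discExt_ne_pt`; `semicircle`, `semicircle_eq_image`,
  `isPreconnected_semicircle`, **`exists_semicircle_arcs`**.
* `cayleyInvFun_re`, `cayleyInvFun_re_sign`, `discArgFrac`,
  `discArgFrac_mem_Icc_of_mem_ball`, `discArgFrac_eq_im`, `differentiableOn_log_cayleyInv`,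
  `tendsto_discArgFrac_lower`, `tendsto_discArgFrac_upper`; `discExt_mem_carrier`,
  `discExt_transfer`, `exists_discExt`.

## References

* S. Smirnov, Ann. of Math. 172 (2010) 1435–1467, end of §5 — bib key `Smirnov2010`.
* Ch. Pommerenke, *Boundary Behaviour of Conformal Maps* (1992), Thm. 2.6.
-/

noncomputable section

namespace Literature.Probability.LatticeModels

open Set Metric Filter _root_.Topology Complex
open Literature.Probability.RandomPlanarGeometry

/-! ### The two arcs of a Dobrushin domain -/

namespace DobrushinArcs

variable (D : RandomPlanarGeometry.DobrushinDomain)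

/-- The two arcs cover the boundary curve. [folklore] -/
theorem arc_union : D.arc 0 ∪ D.arc 1 = frontier D.carrier := by
  have h : (⋃ i, D.arc i) = frontier D.carrier := D.iUnion_arc_holds
  rw [← h]
  ext z
  simp only [mem_union, mem_iUnion]
  constructor
  · rintro (h | h)
    · exact ⟨0, h⟩
    · exact ⟨1, h⟩
  · rintro ⟨i, hi⟩
    fin_cases i
    · exact Or.inl hi
    · exact Or.inr hi

/-- The two arcs meet only at the two marked points `a = pt 0`, `b = pt 1`. [folklore] -/
theorem mem_arc_inter {z : ℂ} (h0 : z ∈ D.arc 0) (h1 : z ∈ D.arc 1) : z = D.pt 0 ∨ z = D.pt 1 := by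
  rcases D.mem_arc_inter_arc (i := 0) (k := 1) (by decide) h0 h1 with h | h
  · exact Or.inl h
  · exact Or.inr h

/-- Each open arc is nonempty: some point of `arc i` is off the other arc. [folklore] -/
theorem exists_mem_arc_not_mem (i : Fin 2) : ∃ z ∈ D.arc i, z ∉ D.arc (i + 1) := by
  have ht := D.midpoint_mem_Ioo i
  refine ⟨D.boundary ((D.mark i + D.nextMark i) / 2), ⟨_, ⟨ht.1.le, ht.2.le⟩, rfl⟩, ?_⟩
  exact D.boundary_not_mem_arc (i := i) (j := i + 1) (by fin_cases i <;> decide) ht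

end DobrushinArcs

/-! ### The disc extension of a chordal uniformizing map -/

section Disc

variable {D : RandomPlanarGeometry.DobrushinDomain} {φ : ConformalEquiv UpperHalfPlane.upperHalfPlaneSet D.carrier}
  {Φ : ℂ → ℂ}

/-- For a chordal uniformizing map, the disc extension sends `1 ↦ b` and `-1 ↦ a`. [folklore] -/
theorem discExt_apply_one (h : JordanDomain.IsDiscExtension D.toJordanDomain φ Φ) (hφ : D.IsChordalUniformizing φ) :
    Φ 1 = D.pt 1 ∧ Φ (-1) = D.pt 0 := by
  refine ⟨h.apply_one_eq hφ.2, ?_⟩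
  have e := h.boundaryExtension_eq (z := 0) (by simp)
  rw [cayleyFun_apply, zero_sub, zero_add, neg_div, div_self Complex.I_ne_zero] at e
  rw [← e]
  exact JordanDomain.boundaryExtension_eq_of_hasBoundaryValue' φ (by simp) hφ.1

/-- Points of the circle other than `±1` are mapped off the marked points. [folklore] -/
theorem discExt_ne_pt (h : JordanDomain.IsDiscExtension D.toJordanDomain φ Φ) (hφ : D.IsChordalUniformizing φ)
    {ζ : ℂ} (hζ : ‖ζ‖ = 1) (h1 : ζ ≠ 1) (h2 : ζ ≠ -1) : Φ ζ ≠ D.pt 0 ∧ Φ ζ ≠ D.pt 1 := by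
  obtain ⟨e1, e2⟩ := discExt_apply_one h hφ
  have hζ' : ζ ∈ closedBall (0 : ℂ) 1 := mem_closedBall_zero_iff.2 hζ.le
  constructor
  · rw [← e2]; intro heq
    exact h2 (h.bijOn.injOn hζ' (mem_closedBall_zero_iff.2 (by simp)) heq)
  · rw [← e1]; intro heq
    exact h1 (h.bijOn.injOn hζ' (mem_closedBall_zero_iff.2 (by simp)) heq)

/-- The upper and lower open semicircles. [folklore] -/
def semicircle (s : Bool) : Set ℂ := {ζ | ‖ζ‖ = 1 ∧ if s then 0 < ζ.im else ζ.im < 0}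

/-- A unit complex number with nonzero imaginary part is `exp(i·arg)` with `arg ∈ (0, π)` or
`(-π, 0)`. [folklore] -/
theorem semicircle_eq_image (s : Bool) :
    semicircle s = (fun θ : ℝ => Complex.exp (θ * I)) '' (if s then Ioo 0 Real.pi else Ioo (-Real.pi) 0) := by
  ext ζ
  constructor
  · rintro ⟨hn, him⟩
    refine ⟨Complex.arg ζ, ?_, ?_⟩
    · have h1 := Complex.neg_pi_lt_arg ζ
      have h2 := Complex.arg_le_pi ζ
      have h0 : Complex.arg ζ ≠ 0 := fun h0 => by
        have := (Complex.arg_eq_zero_iff.1 h0).2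
        split_ifs at him <;> linarith
      have hπ : Complex.arg ζ ≠ Real.pi := fun h0 => by
        have := (Complex.arg_eq_pi_iff.1 h0).2
        split_ifs at him <;> linarith
      cases s
      · simp only [Bool.false_eq_true, if_false] at him ⊢
        have : Complex.arg ζ < 0 := by
          rw [Complex.arg_neg_iff]; exact him
        exact ⟨h1, this⟩
      · simp only [if_true] at him ⊢
        have : 0 ≤ Complex.arg ζ := Complex.arg_nonneg_iff.2 him.le
        exact ⟨lt_of_le_of_ne this (Ne.symm h0), lt_of_le_of_ne h2 hπ⟩
    · have := Complex.norm_mul_exp_arg_mul_I ζ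
      rw [hn, Complex.ofReal_one, one_mul] at this
      exact this
  · rintro ⟨θ, hθ, rfl⟩
    refine ⟨by rw [Complex.norm_exp_ofReal_mul_I], ?_⟩
    rw [Complex.exp_ofReal_mul_I_im]
    cases s
    · simp only [Bool.false_eq_true, if_false] at hθ ⊢
      exact Real.sin_neg_of_neg_of_neg_pi_lt hθ.2 hθ.1
    · simp only [if_true] at hθ ⊢
      exact Real.sin_pos_of_pos_of_lt_pi hθ.1 hθ.2

/-- The semicircles are preconnected. [folklore] -/
theorem isPreconnected_semicircle (s : Bool) : IsPreconnected (semicircle s) := by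
  rw [semicircle_eq_image]
  refine IsPreconnected.image ?_ _ (by fun_prop)
  split_ifs <;> exact isPreconnected_Ioo

/-- **Where the arcs go.** For the disc extension `Φ` of a chordal uniformizing map of the
Dobrushin domain `(D; a, b)`: one of the open semicircles is mapped into the open arc `(ab)` and
the other into the open arc `(ba)` (connectedness of the semicircles, `Φ(±1) = b, a`, and
surjectivity of `Φ` from the circle onto `∂D`). [folklore] -/
theorem exists_semicircle_arcs (h : JordanDomain.IsDiscExtension D.toJordanDomain φ Φ) (hφ : D.IsChordalUniformizing φ) :
    ∃ s : Bool, (∀ ζ ∈ semicircle s, Φ ζ ∈ D.arc 0 ∧ Φ ζ ∉ D.arc 1) ∧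
      (∀ ζ ∈ semicircle (!s), Φ ζ ∈ D.arc 1 ∧ Φ ζ ∉ D.arc 0) := by
  obtain ⟨e1, e2⟩ := discExt_apply_one h hφ
  -- images of the semicircles lie in the boundary minus the marked points
  have hfr : ∀ s, ∀ ζ ∈ semicircle s, Φ ζ ∈ frontier D.carrier ∧ Φ ζ ≠ D.pt 0 ∧ Φ ζ ≠ D.pt 1 := by
    intro s ζ hζ
    have hn := hζ.1
    have him : ζ.im ≠ 0 := by have := hζ.2; split_ifs at this <;> linarith
    have h1 : ζ ≠ 1 := fun e => him (by rw [e]; simp)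
    have h2 : ζ ≠ -1 := fun e => him (by rw [e]; simp)
    exact ⟨h.bijOn_sphere.mapsTo (mem_sphere_zero_iff_norm.2 hn), discExt_ne_pt h hφ hn h1 h2⟩
  have hnotboth : ∀ s, ∀ ζ ∈ semicircle s, ¬ (Φ ζ ∈ D.arc 0 ∧ Φ ζ ∈ D.arc 1) := by
    intro s ζ hζ ⟨h0, h1⟩
    obtain ⟨-, ha, hb⟩ := hfr s ζ hζ
    rcases DobrushinArcs.mem_arc_inter D h0 h1 with e | e
    · exact ha e
    · exact hb e
  have hsome : ∀ s, ∀ ζ ∈ semicircle s, Φ ζ ∈ D.arc 0 ∨ Φ ζ ∈ D.arc 1 := by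
    intro s ζ hζ
    have := (hfr s ζ hζ).1
    rw [← DobrushinArcs.arc_union D] at this
    exact this
  -- each image lies in one open arc
  have hone : ∀ s, (∀ ζ ∈ semicircle s, Φ ζ ∈ D.arc 0 ∧ Φ ζ ∉ D.arc 1) ∨
      (∀ ζ ∈ semicircle s, Φ ζ ∈ D.arc 1 ∧ Φ ζ ∉ D.arc 0) := by
    intro s
    have hpc : IsPreconnected (Φ '' semicircle s) :=
      (isPreconnected_semicircle s).image Φ (h.continuousOn.mono fun ζ hζ => mem_closedBall_zero_iff.2 hζ.1.le)
    by_contra hno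
    rw [not_or] at hno
    obtain ⟨hno0, hno1⟩ := hno
    push Not at hno0 hno1
    obtain ⟨ζ₀, hζ₀, hζ₀'⟩ := hno0
    obtain ⟨ζ₁, hζ₁, hζ₁'⟩ := hno1
    have hz₀ : Φ ζ₀ ∈ (D.arc 0)ᶜ := fun h0 => hnotboth s ζ₀ hζ₀ ⟨h0, hζ₀' h0⟩
    have hz₁ : Φ ζ₁ ∈ (D.arc 1)ᶜ := fun h1 => hnotboth s ζ₁ hζ₁ ⟨hζ₁' h1, h1⟩
    have hcov : Φ '' semicircle s ⊆ (D.arc 1)ᶜ ∪ (D.arc 0)ᶜ := by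
      rintro _ ⟨ζ, hζ, rfl⟩
      by_cases h0 : Φ ζ ∈ D.arc 0
      · exact Or.inl fun h1 => hnotboth s ζ hζ ⟨h0, h1⟩
      · exact Or.inr h0
    obtain ⟨z, ⟨ζ, hζ, rfl⟩, hzu, hzv⟩ := hpc _ _ (D.isClosed_arc 1).isOpen_compl (D.isClosed_arc 0).isOpen_compl hcov
      ⟨Φ ζ₁, ⟨ζ₁, hζ₁, rfl⟩, hz₁⟩ ⟨Φ ζ₀, ⟨ζ₀, hζ₀, rfl⟩, hz₀⟩
    rcases hsome s ζ hζ with h0 | h1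
    · exact hzv h0
    · exact hzu h1
  -- every open arc is hit by some semicircle
  have hsurj : ∀ i : Fin 2, ∃ s, ∃ ζ ∈ semicircle s, Φ ζ ∈ D.arc i ∧ Φ ζ ∉ D.arc (i + 1) := by
    intro i
    obtain ⟨z, hz, hz'⟩ := DobrushinArcs.exists_mem_arc_not_mem D i
    obtain ⟨ζ, hζ, rfl⟩ := h.bijOn_sphere.surjOn (D.arc_subset_frontier i hz)
    have hn : ‖ζ‖ = 1 := mem_sphere_zero_iff_norm.1 hζ
    have him : ζ.im ≠ 0 := by
      intro him
      have h2 : ζ.re ^ 2 = 1 := by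
        have := Complex.sq_norm ζ; rw [hn, Complex.normSq_apply, him] at this; nlinarith [this]
      have hre : ζ.re = 1 ∨ ζ.re = -1 := by
        have : (ζ.re - 1) * (ζ.re + 1) = 0 := by nlinarith
        rcases mul_eq_zero.1 this with h' | h'
        · exact Or.inl (by linarith)
        · exact Or.inr (by linarith)
      have hmarked : Φ ζ = D.pt 1 ∨ Φ ζ = D.pt 0 := by
        rcases hre with hre | hre
        · left; rw [← e1]; congr 1; exact Complex.ext (by simp [hre]) (by simp [him])
        · right; rw [← e2]; congr 1; exact Complex.ext (by simp [hre]) (by simp [him])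
      apply hz'
      rcases hmarked with e | e <;> rw [e, D.pt_mem_arc_iff] <;> fin_cases i <;> decide
    by_cases hs : 0 < ζ.im
    · exact ⟨true, ζ, ⟨hn, by simp [hs]⟩, hz, hz'⟩
    · exact ⟨false, ζ, ⟨hn, by simp only [Bool.false_eq_true, if_false]; exact lt_of_le_of_ne (not_lt.1 hs) him⟩, hz, hz'⟩
  -- conclude
  obtain ⟨s, ζ, hζ, hζ0, hζ1⟩ := hsurj 0
  obtain ⟨s', ζ', hζ', hζ'1, hζ'0⟩ := hsurj 1
  have hP : ∀ ξ ∈ semicircle s, Φ ξ ∈ D.arc 0 ∧ Φ ξ ∉ D.arc 1 := by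
    rcases hone s with hP | hQ
    · exact hP
    · exact absurd hζ0 (hQ ζ hζ).2
  have hQ : ∀ ξ ∈ semicircle s', Φ ξ ∈ D.arc 1 ∧ Φ ξ ∉ D.arc 0 := by
    rcases hone s' with hP' | hQ'
    · exact absurd hζ'1 (hP' ζ' hζ').2
    · exact hQ'
  have hss' : s' = !s := by
    by_contra hne
    have : s' = s := by cases s <;> cases s' <;> simp_all
    subst this
    exact (hP ζ' hζ').2 (hQ ζ' hζ').1
  subst hss'
  exact ⟨s, hP, hQ⟩

/-! ### The inverse Cayley transform on the circle and the comparison harmonic function -/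

/-- Real part of the inverse Cayley transform: `re (i(1+w)/(1-w)) = -2 im w / |1-w|²`. [folklore] -/
theorem cayleyInvFun_re (w : ℂ) : (cayleyInvFun w).re = -2 * w.im / normSq (1 - w) := by
  rw [cayleyInvFun_apply, mul_div_assoc, Complex.mul_re, Complex.I_re, Complex.I_im, zero_mul, one_mul, zero_sub,
    Complex.div_im, neg_sub, ← sub_div]
  congr 1
  simp only [Complex.add_re, Complex.one_re, Complex.sub_re, Complex.add_im, Complex.one_im, Complex.sub_im, zero_add,
    zero_sub]
  ring

/-- On the lower open semicircle the inverse Cayley transform is a positive real, on the upper one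
a negative real. [folklore] -/
theorem cayleyInvFun_re_sign {ζ : ℂ} (him : ζ.im ≠ 0) :
    (0 < (cayleyInvFun ζ).re ↔ ζ.im < 0) ∧ ((cayleyInvFun ζ).re < 0 ↔ 0 < ζ.im) := by
  have h1 : ζ ≠ 1 := fun e => him (by rw [e]; simp)
  have hn : 0 < normSq (1 - ζ) := Complex.normSq_pos.2 (sub_ne_zero.2 (Ne.symm h1))
  rw [cayleyInvFun_re]
  constructor
  · rw [lt_div_iff₀ hn, zero_mul]; constructor <;> intro h <;> linarith
  · rw [div_lt_iff₀ hn, zero_mul]; constructor <;> intro h <;> linarith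

/-- **The comparison function of the disc**: `ϖ(w) = arg(cayley⁻¹ w)/π`, the harmonic measure of
the negative real axis seen from `cayley⁻¹ w ∈ ℍ`. [folklore] -/
def discArgFrac (w : ℂ) : ℝ := Complex.arg (cayleyInvFun w) / Real.pi

/-- On the open disc `ϖ ∈ [0, 1]` (`cayley⁻¹ w ∈ ℍ`). [folklore] -/
theorem discArgFrac_mem_Icc_of_mem_ball {w : ℂ} (hw : w ∈ ball (0 : ℂ) 1) : discArgFrac w ∈ Icc (0 : ℝ) 1 := by
  have him := cayleyInvFun_im_pos (mem_ball_zero_iff.1 hw)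
  unfold discArgFrac
  refine ⟨div_nonneg (Complex.arg_nonneg_iff.2 him.le) Real.pi_pos.le, ?_⟩
  rw [div_le_one Real.pi_pos]; exact Complex.arg_le_pi _

/-- On the open disc `ϖ = Im (log (cayley⁻¹ w))/π` with `log ∘ cayley⁻¹` holomorphic. [folklore] -/
theorem discArgFrac_eq_im {w : ℂ} :
    discArgFrac w = (((Real.pi : ℂ)⁻¹ * Complex.log (cayleyInvFun w))).im := by
  unfold discArgFrac
  rw [← Complex.ofReal_inv]
  simp [Complex.log_im]
  ring

/-- The holomorphic function behind `ϖ` on the disc. [folklore] -/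
theorem differentiableOn_log_cayleyInv :
    DifferentiableOn ℂ (fun w => (Real.pi : ℂ)⁻¹ * Complex.log (cayleyInvFun w)) (ball (0 : ℂ) 1) := by
  intro w hw
  have hw1 : w ≠ 1 := by rintro rfl; simp at hw
  have him := cayleyInvFun_im_pos (mem_ball_zero_iff.1 hw)
  have d1 : DifferentiableAt ℂ cayleyInvFun w :=
    (differentiableOn_cayleyInvFun w hw1).differentiableAt ((isOpen_ne.mem_nhds hw1))
  exact (((Complex.differentiableAt_log (Or.inr him.ne')).comp w d1).const_mul _).differentiableWithinAt

/-- **Boundary values of `ϖ` on the lower semicircle**: `ϖ → 0`. [folklore] -/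
theorem tendsto_discArgFrac_lower {ζ : ℂ} (hζ : ‖ζ‖ = 1) (him : ζ.im < 0) :
    Tendsto discArgFrac (𝓝[ball (0 : ℂ) 1] ζ) (𝓝 0) := by
  have h1 : ζ ≠ 1 := fun e => by rw [e] at him; simp at him
  have hre : 0 < (cayleyInvFun ζ).re := ((cayleyInvFun_re_sign him.ne).1).2 him
  have hc : ContinuousAt cayleyInvFun ζ :=
    ((differentiableOn_cayleyInvFun ζ h1).differentiableAt (isOpen_ne.mem_nhds h1)).continuousAt
  have harg : ContinuousAt Complex.arg (cayleyInvFun ζ) := Complex.continuousAt_arg (Or.inl hre)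
  have h0 : Complex.arg (cayleyInvFun ζ) = 0 := by
    rw [Complex.arg_eq_zero_iff]; exact ⟨hre.le, cayleyInvFun_im_eq_zero hζ⟩
  have : Tendsto (fun w => Complex.arg (cayleyInvFun w) / Real.pi) (𝓝 ζ) (𝓝 (Complex.arg (cayleyInvFun ζ) / Real.pi)) :=
    ((harg.comp hc).tendsto).div_const _
  rw [h0, zero_div] at this
  exact this.mono_left nhdsWithin_le_nhds

/-- **Boundary values of `ϖ` on the upper semicircle**: `ϖ → 1` (approaching the negative real
axis from the upper half-plane). [folklore] -/
theorem tendsto_discArgFrac_upper {ζ : ℂ} (hζ : ‖ζ‖ = 1) (him : 0 < ζ.im) :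
    Tendsto discArgFrac (𝓝[ball (0 : ℂ) 1] ζ) (𝓝 1) := by
  have h1 : ζ ≠ 1 := fun e => by rw [e] at him; simp at him
  have hre : (cayleyInvFun ζ).re < 0 := ((cayleyInvFun_re_sign him.ne').2).2 him
  have hc : ContinuousAt cayleyInvFun ζ :=
    ((differentiableOn_cayleyInvFun ζ h1).differentiableAt (isOpen_ne.mem_nhds h1)).continuousAt
  -- `cayley⁻¹` tends to its value within `{im ≥ 0}` along the disc
  have hwithin : Tendsto cayleyInvFun (𝓝[ball (0 : ℂ) 1] ζ) (𝓝[{z : ℂ | 0 ≤ z.im}] (cayleyInvFun ζ)) := by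
    refine tendsto_nhdsWithin_iff.2 ⟨hc.tendsto.mono_left nhdsWithin_le_nhds, ?_⟩
    filter_upwards [self_mem_nhdsWithin] with w hw
    exact (cayleyInvFun_im_pos (mem_ball_zero_iff.1 hw)).le
  have harg := Complex.tendsto_arg_nhdsWithin_im_nonneg_of_re_neg_of_im_zero hre (cayleyInvFun_im_eq_zero hζ)
  have := (harg.comp hwithin).div_const Real.pi
  rw [div_self Real.pi_pos.ne'] at this
  exact this

/-! ### Transfer of boundary behaviour from `D` to the disc -/

/-- Points of the open disc are mapped into `D` by the disc extension. [folklore] -/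
theorem discExt_mem_carrier (h : JordanDomain.IsDiscExtension D.toJordanDomain φ Φ) {w : ℂ} (hw : w ∈ ball (0 : ℂ) 1) :
    Φ w ∈ D.carrier := by
  rw [h.eqOn hw]
  exact (cayley.symm.trans φ).mapsTo hw

/-- **Transfer of boundary estimates.** If a function `hD` on `D` is within `η` of `L` on
`D ∩ ball (Φ ζ) ρ`, then `hD ∘ Φ` is within `η` of `L` near `ζ` in the disc (continuity of `Φ`
on the closed disc). [folklore] -/
theorem discExt_transfer (h : JordanDomain.IsDiscExtension D.toJordanDomain φ Φ) {ζ : ℂ} (hζ : ‖ζ‖ = 1)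
    {hD : ℂ → ℝ} {L η ρ : ℝ} (hρ : 0 < ρ) (hb : ∀ z ∈ D.carrier, dist z (Φ ζ) < ρ → |hD z - L| ≤ η) :
    ∃ V ∈ 𝓝 ζ, ∀ w ∈ V ∩ ball (0 : ℂ) 1, |hD (Φ w) - L| ≤ η := by
  have hζ' : ζ ∈ closedBall (0 : ℂ) 1 := mem_closedBall_zero_iff.2 hζ.le
  have hc := h.continuousOn ζ hζ'
  have : ∀ᶠ w in 𝓝[closedBall (0 : ℂ) 1] ζ, dist (Φ w) (Φ ζ) < ρ :=
    (Metric.tendsto_nhds.1 hc) ρ hρ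
  obtain ⟨V, hV, hVsub⟩ := eventually_nhdsWithin_iff.1 this |> Filter.Eventually.exists_mem
  refine ⟨V, hV, fun w hw => hb _ (discExt_mem_carrier h hw.2) (hVsub w hw.1 (ball_subset_closedBall hw.2))⟩

/-- Every chordal uniformizing map has a disc extension (Carathéodory's theorem, proved in the
tree). [cite: PommerenkeBBCM1992, Thm. 2.6] -/
theorem exists_discExt (φ : ConformalEquiv UpperHalfPlane.upperHalfPlaneSet D.carrier) :
    ∃ Φ, JordanDomain.IsDiscExtension D.toJordanDomain φ Φ :=
  JordanDomain.exists_isDiscExtension JordanDomain.exists_continuousOn_extension_holds φ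

end Disc

end Literature.Probability.LatticeModels
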